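import Literature.Analysis.FluidPDE.PassiveVectorLionsExistence
import Summits.AnomalousDissipation.AnomalousDissipation.Theorems.SolenoidalFractalHomogenisationLagrangianStepDefs
import Summits.AnomalousDissipation.AnomalousDissipation.Theorems.SolenoidalFractalHomogenisationLagrangianRenormalisationStepExistsL
import Summits.AnomalousDissipation.AnomalousDissipation.Theorems.SolenoidalFractalHomogenisationPermissibleFractalCarrierWords
import Summits.AnomalousDissipation.AnomalousDissipation.Theorems.SolenoidalFractalHomogenisationProjectedRenormalisationStepDefs
import HarnessLib

/-!
# K1 `ProjectedRenormalisationStep` (stmt-AnomalousDissipation-19071): registered stub `stub_exists` — A0 weak existence for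
# the renormalised truncated problems

Helper file of route `SolenoidalFractalHomogenisation` (`--supports stmt-AnomalousDissipation-19071`; registered birth skeleton
`HOME/ad-ideate-p1/route/bc/ProjectedRenormalisationStep_birth-route.lean`, sha `e2b567d2f478eabc…`, stubs `stub_exists`,
`stub_energy`, `stub_base`, `stub_cascade`, `stub_tail`; shared vocabulary `…ProjectedRenormalisationStepDefs`).
`stub_exists` (text verbatim): for every fractal shear carrier `D : FractalCarrierData k`, every level `m` and every admissible
datum (`IsDatum`: `H¹`, mean zero, weakly divergence free) the truncated problem `P_m(D)` — passive solenoidal vector (`A = 0`)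
along `carrierUpTo D m = level 1 + ⋯ + level m` at viscosity `D.kbar m` — has a weak solution on `[0,1)` (`TruncSol`).
Proof: each Eulerian lattice level is jointly continuous (`LagrangianRenormalisationStep.continuous_uncurry_level`) and weakly
divergence free (`PermissibleCarrier.isWeaklyDivFree_level`), so the finite sum is bounded on `(0,1) × 𝕋³` with divergence-free
slices, and J.-L. Lions' theorem `Torus.exists_isWeakPassiveVectorOn` applies.  No hypothesis on `D` is needed.
The item is an ASIDE of the route (superseded by K1L_D); this is generic A0 infrastructure, NOT a proof of the crux nor of
anomalous dissipation.  Rung F-D1.A0.  Prover seat `leafhand-ad-solenoidalfractalh-1` g0.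
-/

set_option linter.dupNamespace false

noncomputable section

namespace Summit.AnomalousDissipation.AnomalousDissipation.Theorems.SolenoidalFractalHomogenisation.ProjectedRenormalisationStep

open Literature.Analysis Literature.Analysis.FluidPDE Literature.Analysis.FunctionSpaces
open MeasureTheory Set Filter Function
open scoped ENNReal NNReal
open Literature.Analysis.FunctionSpaces.Torus (IsWeaklyDivFree stLift)
open Summit.AnomalousDissipation.AnomalousDissipation.Theorems.SolenoidalFractalHomogenisation.LagrangianStep (IsDatum InClass)
open Summit.AnomalousDissipation.AnomalousDissipation.Theorems.SolenoidalFractalHomogenisation.LagrangianRenormalisationStep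
  (continuous_uncurry_level memLp_top_stLift_of_continuous)
open Summit.AnomalousDissipation.AnomalousDissipation.Theorems.SolenoidalFractalHomogenisation.PermissibleCarrier (isWeaklyDivFree_level)
open Summit.AnomalousDissipation.AnomalousDissipation.Theorems.SolenoidalFractalHomogenisation.RealisedQuasiStaticCellLaw
  (memLp_two_of_memSobolev_one_complexify)


variable {k : ℕ}

/-- The truncated carrier `carrierUpTo D m` (levels `1..m`, each an Eulerian lattice level) is jointly continuous on
`ℝ × 𝕋³`. [folklore] -/
theorem continuous_uncurry_carrierUpTo (D : LatticeShear.FractalCarrierData k) (m : ℕ) :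
    Continuous (uncurry (carrierUpTo D m)) := by
  have e : uncurry (carrierUpTo D m) = fun p : ℝ × UnitAddTorus (Fin 3) => ∑ i ∈ Finset.range m, uncurry (D.level (i + 1)) p := by
    funext ⟨t, x⟩
    simp [carrierUpTo]
  rw [e]
  exact continuous_finsetSum _ fun i _ => continuous_uncurry_level D (i + 1)

/-- The truncated carrier `carrierUpTo D m` is weakly divergence free at every time (its levels are, and Temam's
space `H` is linear). [cite: Temam1984, Ch. I §1.4 (the space H)] -/
theorem isWeaklyDivFree_carrierUpTo (D : LatticeShear.FractalCarrierData k) (m : ℕ) (t : ℝ) :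
    IsWeaklyDivFree (carrierUpTo D m t) := by
  induction m with
  | zero =>
    intro θ _
    simp [carrierUpTo]
  | succ m ih =>
    have e : carrierUpTo D (m + 1) t = fun x => carrierUpTo D m t x + D.level (m + 1) t x := by
      funext x
      simp [carrierUpTo, Finset.sum_range_succ]
    rw [e]
    have hcont_m : Continuous (carrierUpTo D m t) := (continuous_uncurry_carrierUpTo D m).uncurry_left t
    have hcont_b : Continuous (D.level (m + 1) t) := (continuous_uncurry_level D (m + 1)).uncurry_left t
    exact ih.add_of_integrable (isWeaklyDivFree_level D (m + 1) t) hcont_m.integrable_unitAddTorus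
      hcont_b.integrable_unitAddTorus

/-- The space–time lift of the truncated carrier is essentially bounded on every slab `(0,T) × 𝕋³`. [folklore] -/
theorem memLp_top_stLift_carrierUpTo (D : LatticeShear.FractalCarrierData k) (m : ℕ) (T : ℝ) :
    MemLp (stLift (carrierUpTo D m)) ∞ (volume.restrict (Ioo 0 T ×ˢ (univ : Set (EuclideanSpace ℝ (Fin 3))))) :=
  memLp_top_stLift_of_continuous (continuous_uncurry_carrierUpTo D m) T

/-- **Registered stub `stub_exists` (K1 skeleton e2b567d2, text verbatim): A0 weak existence for the
truncated problems.**  For every fractal shear carrier `D`, level `m` and admissible datum `w₀` (`H¹`, mean zero, weakly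
divergence free) the renormalised truncated problem `P_m(D)` — passive solenoidal vector along `carrierUpTo D m` at
viscosity `D.kbar m > 0` — has a weak solution on `[0,1)`: J.-L. Lions' theorem `Torus.exists_isWeakPassiveVectorOn`, the
carrier being a finite sum of jointly continuous, weakly divergence-free Eulerian lattice levels.
[cite: LionsMagenes1972, Chap. 3 Thm. 1.1] -/
theorem stub_exists : ∀ k (D : LatticeShear.FractalCarrierData k) (m : ℕ) (w₀ : UnitAddTorus (Fin 3) → EuclideanSpace ℝ (Fin 3)),
    IsDatum w₀ → ∃ u, TruncSol D m w₀ u := by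
  intro k D m w₀ hw₀
  exact Torus.exists_isWeakPassiveVectorOn one_pos (D.kbar_pos m) (memLp_top_stLift_carrierUpTo D m 1)
    (ae_of_all _ fun t => isWeaklyDivFree_carrierUpTo D m t) (memLp_two_of_memSobolev_one_complexify hw₀.1) hw₀.2.2

end Summit.AnomalousDissipation.AnomalousDissipation.Theorems.SolenoidalFractalHomogenisation.ProjectedRenormalisationStep

end
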